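/-
Copyright (c) 2026. All rights reserved.
Released under Apache 2.0 license as described in the file LICENSE.
Authors: HodgeCM-Mathlib publication cell (pub/hodgecm-mathlib), floor-0 programme P4, seat F0P4-p06.
-/
import Literature.NumberTheory.GelbartRogawski1991.UndoublingPlaceAssembly
import Literature.NumberTheory.GelbartRogawski1991.DoubledWeilRepresentationArchHalf
import Literature.NumberTheory.GelbartRogawski1991.DoubledWeilRepresentationCMExplicit
import Literature.NumberTheory.Automorphic.Liu2021.Def411WeilCarriersDoublingUnique
import HarnessLib

/-!
# The finite Weil representation of a unitary pair at the `χ`-attached splitting of a line IS the place-assembled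
# `⊗'_v ω_v` of the CM local family (general rank `N`)

Topic `NumberTheory/GelbartRogawski1991`; namespace `Literature.NumberTheory.GelbartRogawski1991.UnitaryDualPair.WeilCoinv`.
KERNEL ONLY: theorems, no definition, no named fact, no `sorry`; nothing of [GelbartRogawski1991], [Kudla1994], [Liu2021] is
asserted.

Setting: a CM field `L` (`L⁺ = Fp L`, conjugation `c̄`), a real non-degenerate diagonal frame `dV : Fin N → L` with an enumeration
`e : Fin N × Fin 1 ≃ Fin n`, a hermitian LINE with Gram data `T_W ∈ M₁(L⁺)` (symmetric, `det` a unit) and `J_W = T_W ⊗ 1`, and a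
unitary Hecke character `χ` of `L` with the splitting condition for `dim W = 1` (`IsSplittingChar L 1 χ`).  The tree attaches to `χ`
the compatible splitting **`chiSplittingLine L e dV … χ … T_W … J_W …`** of the pair datum `U(diag dV) × U(J_W)`
(`Liu2021/Def411WeilCarriersDoubling`: the undoubling of THE `χ`-normalised doubled Weil representation, [Kudla1994, Thm. 3.1],
[HarrisKudlaSweet1996, (1.14)–(1.15)]; `isCompatible_chiSplittingLine`), and, place by place, the `χ`-normalised CM local family of
the doubled group undoubled and read on `(diag dV, J_W)`:
`𝓢_χ := congrW … (undoubledSplittings … χ (borelPlaceMeasure L) (cmFinLocalFamily … χ … (borelPlaceMeasure L))) hW hJW`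
(`UndoublingPlaceAssembly`, `DoubledWeilRepresentationCMExplicit`) — Liu's `ι_{μ_v}` at every finite place.  This file records, for
GENERAL rank `N` and GENERAL line Gram data, the junction the cell's line-transport programme (crux H413, stub
`StubT3aLineTransportAt`, roadmap item (P′5)) consumes:

* §1 **`pairSmall₁_chiSplittingLine_comp_finPairToAdelic`** — «undoubling commutes with place-assembly» at the `χ`-line: the
  `χ`-attached splitting read on the finite-adelic pair `U(diag dV)(𝔸_f) × U(J_W)(𝔸_f)` IS the reference section
  `localRefSection … 𝓢_χ` ASSEMBLED FROM THE LOCAL SPLITTINGS (the rank-3 instance at the cell's pin is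
  `OmegaChiSplitting.hfac_sChiD`; the proof is the same three tree facts: `exists_isArchHalf`,
  `chiSplittingLine_eq_splittingCongr_undoubleHom`, `pairSmall₁_splittingCongr_undoubleHom_assemble_eq_localRefSection`);
* §2 **`finPairRep_chiSplittingLine_apply`** — hence the finite Weil representation of the pair at the `χ`-line is the
  place-assembled `Ω = ⊗'_v ω_v` of `𝓢_χ` read on the pair: `ω_f(k, u) f = R_e⁻¹ (Ω(reindex (k ⊗ u)) (R_e f))`
  (`finRepMp_localRefSection_apply`); on pure tensors `⊗_v Φ_v` it acts factor by factor through the local Weil representations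
  `ω_v = 𝓢_χ.omegaLoc v` (`finPairRep_chiSplittingLine_symm_piProdSB`, via `FinLocalSplittings.Omega_piProdSB`) — the «`⊗'`»
  structure of [Liu2021, Def. 4.11] `ω(μ, ε, χ) = ⊗'_v ω(μ_v, ε_v, χ_v)` for the splitting OF RECORD, as a theorem;
* §3 the two members separately (`finPairRepV_chiSplittingLine_apply`, `finPairRepW_chiSplittingLine_apply`).

CENSUS NOTE for the consumers (not used in any proof here): the local family `𝓢_χ` is LITERALLY the `congrW … (undoubledSplittings …)`
term of the per-place naturality theorem `LocalSplitting.lineTransportSplitting_lineTransportSection_congrW_undoubledSplittings_holds`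
(`LocalLineIsometryNaturalityHolds`), which is stated at the enumeration `e := Equiv.prodUnique (Fin N) (Fin 1)`.

## References
* [GelbartRogawski1991] S. Gelbart, J. Rogawski, Invent. Math. 105 (1991), §3.1 Prop. 3.1.1 p. 455 L1–3, Remark p. 457 L4–13.
* [Kudla1994] S. Kudla, Israel J. Math. 87 (1994), §3 Thm. 3.1.
* [HarrisKudlaSweet1996] M. Harris, S. Kudla, W. Sweet, J. AMS 9 (1996), §1 (1.14)–(1.15).
* [Liu2021] Y. Liu, Camb. J. Math. 9 (2021), Def. 4.11 (l. 2092–2096), App. D §D.1 Steps 1–3 (l. 5217–5221).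
* [Weil1964] A. Weil, Acta Math. 111 (1964), Chap. III n° 37–38 pp. 188–190.
-/

set_option autoImplicit false

noncomputable section

open scoped Matrix Kronecker TensorProduct
open NumberField IsDedekindDomain MeasureTheory
open Literature.RepresentationTheory.HeisenbergGroup
open Literature.NumberTheory.Weil1964
open Literature.NumberTheory.Automorphic Literature.NumberTheory.Automorphic.UnitaryGroup
open Literature.NumberTheory.GaloisRepresentations
open Literature.RepresentationTheory.HarrisKudlaSweet1996
open Literature.NumberTheory.Automorphic.Liu2021.Def411WeilCarriersDoubling
open Literature.NumberTheory.GelbartRogawski1991.GRConstruction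

namespace Literature.NumberTheory.GelbartRogawski1991.UnitaryDualPair.WeilCoinv

variable (L : Type) [Field L] [NumberField L] [IsCMField L] {N n : ℕ} (e : Fin N × Fin 1 ≃ Fin n)
  (dV : Fin N → L) (hdV : ∀ i, IsCMField.complexConj L (dV i) = dV i) (hdV0 : ∀ i, dV i ≠ 0)
  (χ : HeckeCharacter L) (hχu : χ.IsUnitary) (hχs : IsSplittingChar L 1 χ)
  (TW : Matrix (Fin 1) (Fin 1) (Fp L)) (hW : TW.IsSymm) (hWd : IsUnit TW.det) (JW : Matrix (Fin 1) (Fin 1) L)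
  (hJW : JW = TW.map (algebraMap (Fp L) L))

/-! ## §1 Undoubling commutes with place-assembly at the `χ`-line (general rank) -/

set_option maxHeartbeats 1600000 in
-- heartbeats: the statement carries the `splittingDatum` telescope of the reference section and the CM local family twice
-- (as the rank-3 instance `OmegaChiSplitting.hfac_sChiD`, which needs 4 000 000); the default budget times out at `isDefEq`.
/-- **The `χ`-attached splitting of the line, read on the finite-adelic pair, IS the reference section assembled from the
`χ`-normalised CM local family** (general rank `N`, general line Gram data): `(pairSmall₁ s_χ) ∘ finPairToAdelic = localRefSection 𝓢_χ`.
Proof: `s_χ` is the transported undoubling of the EXPLICIT `χ`-normalised doubled Weil representation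
`assemble (finHalf (cmFinLocalFamily χ …)) sa` (any archimedean half `sa`, `exists_isArchHalf`;
`chiSplittingLine_eq_splittingCongr_undoubleHom`), and undoubling commutes with place-assembly
(`pairSmall₁_splittingCongr_undoubleHom_assemble_eq_localRefSection`).
[cite: GelbartRogawski1991, §3.1 Prop. 3.1.1 p. 455 L1–3, Remark p. 457 L4–13] [cite: Liu2021, App. D §D.1 Step 2 (l. 5219)] -/
theorem pairSmall₁_chiSplittingLine_comp_finPairToAdelic :
    (pairSmall₁ (Fp L) L (IsCMField.complexConj L) N 1 e (Matrix.diagonal dV) JW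
        (chiSplittingLine L e dV hdV hdV0 χ hχu hχs TW hWd JW hJW)).comp
      (finPairToAdelic (Fp L) L (IsCMField.complexConj L) N 1 (Matrix.diagonal dV) JW) =
    localRefSection (Fp L) L (IsCMField.complexConj L) N 1 e (Matrix.diagonal dV) JW (complexConj_imagUnit L)
      (imagUnit_ne_zero L) (imagUnit_mul_self L) (realDiagonal_isSymm L dV hdV) hW (realDiagonal_map L dV hdV).symm hJW
      (congrW L e dV hdV (lineW L TW) (complexConj_lineW L TW) (realDiagonal_lineW L TW) (diagonal_lineW L TW hJW)
        (undoubledSplittings L e dV hdV hdV0 (lineW L TW) (complexConj_lineW L TW) (lineW_ne_zero L TW hWd) χ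
          (borelPlaceMeasure L)
          (cmFinLocalFamily L e dV hdV hdV0 (lineW L TW) (complexConj_lineW L TW) (lineW_ne_zero L TW hWd) χ hχs
            (borelPlaceMeasure L)))
        hW hJW) := by
  obtain ⟨sa, ha⟩ := exists_isArchHalf L e dV hdV hdV0 (lineW L TW) (complexConj_lineW L TW) (lineW_ne_zero L TW hWd)
    χ hχu hχs
  have hs := chiSplittingLine_eq_splittingCongr_undoubleHom L e dV hdV hdV0 χ hχu hχs TW hWd JW hJW
    (isDoubledWeilRep_assemble L e dV hdV hdV0 (lineW L TW) (complexConj_lineW L TW) (lineW_ne_zero L TW hWd) χ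
      (finHalf_isFinHalf L e dV hdV hdV0 (lineW L TW) (complexConj_lineW L TW) (lineW_ne_zero L TW hWd) χ
        (borelPlaceMeasure L)
        (cmFinLocalFamily L e dV hdV hdV0 (lineW L TW) (complexConj_lineW L TW) (lineW_ne_zero L TW hWd) χ hχs
          (borelPlaceMeasure L)))
      ha)
  have key := pairSmall₁_splittingCongr_undoubleHom_assemble_eq_localRefSection L e dV hdV hdV0 (lineW L TW)
    (complexConj_lineW L TW) (lineW_ne_zero L TW hWd) χ (borelPlaceMeasure L)
    (cmFinLocalFamily L e dV hdV hdV0 (lineW L TW) (complexConj_lineW L TW) (lineW_ne_zero L TW hWd) χ hχs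
      (borelPlaceMeasure L))
    (realDiagonal_lineW L TW) (diagonal_lineW L TW hJW) hW hJW ha
  exact (congrArg (fun s => (pairSmall₁ (Fp L) L (IsCMField.complexConj L) N 1 e (Matrix.diagonal dV) JW s).comp
    (finPairToAdelic (Fp L) L (IsCMField.complexConj L) N 1 (Matrix.diagonal dV) JW)) hs).trans key

/-! ## §2 The finite Weil representation at the `χ`-line is `⊗'_v ω_v` read on the pair -/

/-- **`ω_f^{s_χ}(k, u) f = R_e⁻¹ (Ω_χ(reindex (k ⊗ u)) (R_e f))`**: the finite Weil representation of the pair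
`U(diag dV)(𝔸_f) × U(J_W)(𝔸_f)` at the `χ`-attached splitting of the line is the place-assembled `Ω_χ = ⊗'_v ω_v` of the CM local
family `𝓢_χ`, read on the pair through the Kronecker re-indexing `R_e = finSBReindex L⁺ e` (`finRepMp_localRefSection_apply` at
the section of §1).  [Liu2021, Def. 4.11]'s `⊗'_v` for the splitting of record, as a theorem.
[cite: GelbartRogawski1991, §3.1 Prop. 3.1.1 p. 455 L1–3] [cite: Liu2021, Def. 4.11 (l. 2092–2096), App. D §D.1 Steps 2–3 (l. 5217–5221)]
[cite: Weil1964, Chap. III n° 37–38 pp. 188–190] -/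
theorem finPairRep_chiSplittingLine_apply
    (p : UnitaryGroup.finAdelic (Fp L) L (IsCMField.complexConj L) N (Matrix.diagonal dV) ×
      UnitaryGroup.finAdelic (Fp L) L (IsCMField.complexConj L) 1 JW)
    (f : FinSB (Fp L) (Fin N × Fin 1)) :
    finPairRep (Fp L) L (IsCMField.complexConj L) N 1 e (Matrix.diagonal dV) JW (complexConj_imagUnit L)
        (imagUnit_ne_zero L) (imagUnit_mul_self L) (realDiagonal_isSymm L dV hdV) hW
        (isUnit_det_realDiagonal L dV hdV hdV0) hWd (realDiagonal_map L dV hdV).symm hJW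
        (isCompatible_chiSplittingLine L e dV hdV hdV0 χ hχu hχs TW hW hWd JW hJW) p f =
      (finSBReindex (Fp L) e).symm
        ((congrW L e dV hdV (lineW L TW) (complexConj_lineW L TW) (realDiagonal_lineW L TW) (diagonal_lineW L TW hJW)
            (undoubledSplittings L e dV hdV hdV0 (lineW L TW) (complexConj_lineW L TW) (lineW_ne_zero L TW hWd) χ
              (borelPlaceMeasure L)
              (cmFinLocalFamily L e dV hdV hdV0 (lineW L TW) (complexConj_lineW L TW) (lineW_ne_zero L TW hWd) χ hχs
                (borelPlaceMeasure L)))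
            hW hJW).Omega
          (finPairEmb (Fp L) L (IsCMField.complexConj L) N 1 e (Matrix.diagonal dV) JW p) (finSBReindex (Fp L) e f)) := by
  have hsec := DFunLike.congr_fun
    (pairSmall₁_chiSplittingLine_comp_finPairToAdelic L e dV hdV hdV0 χ hχu hχs TW hW hWd JW hJW) p
  -- `finPairRep hs p = finPart (ω ((pairSmall₁ s_χ ∘ finPairToAdelic) p))`, and the section value is `localRefSection 𝓢_χ p`
  refine (LinearMap.congr_fun (congrArg (fun x => finPart (Fp L) (Fin N × Fin 1)
    (adelicMpCont.omega (Fp L) (Fin N × Fin 1) _ x)) hsec) f).trans ?_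
  exact finRepMp_localRefSection_apply (Fp L) L (IsCMField.complexConj L) N 1 e (Matrix.diagonal dV) JW
    (complexConj_imagUnit L) (imagUnit_ne_zero L) (imagUnit_mul_self L) (realDiagonal_isSymm L dV hdV) hW
    (isUnit_det_realDiagonal L dV hdV hdV0) hWd (realDiagonal_map L dV hdV).symm hJW _
    (isCompatible_chiSplittingLine L e dV hdV hdV0 χ hχu hχs TW hW hWd JW hJW) p f

/-- **on pure tensors the finite Weil representation at the `χ`-line acts place by place**: for a restricted family `Φ = (Φ_v)_v` of
local Schwartz–Bruhat functions, `ω_f^{s_χ}(k, u) (R_e⁻¹ (⊗_v Φ_v)) = R_e⁻¹ (⊗_v ω_v((k ⊗ u)_v) Φ_v)` with `ω_v = 𝓢_χ.omegaLoc v`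
the local Weil representation of `U(diag dV ⊗ J_W)(L⁺_v)` at Liu's `ι_{μ_v}` (`FinLocalSplittings.Omega_piProdSB`).
[cite: Liu2021, Def. 4.11 (l. 2092–2096), App. D §D.1 Steps 2–3 (l. 5217–5221)] [cite: Weil1964, Chap. III n° 37–38 pp. 188–190] -/
theorem finPairRep_chiSplittingLine_symm_piProdSB [DecidableEq (HeightOneSpectrum (𝓞 (Fp L)))]
    (p : UnitaryGroup.finAdelic (Fp L) L (IsCMField.complexConj L) N (Matrix.diagonal dV) ×
      UnitaryGroup.finAdelic (Fp L) L (IsCMField.complexConj L) 1 JW)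
    (Φ : LocalSBFamily (Fp L) (Fin n)) :
    finPairRep (Fp L) L (IsCMField.complexConj L) N 1 e (Matrix.diagonal dV) JW (complexConj_imagUnit L)
        (imagUnit_ne_zero L) (imagUnit_mul_self L) (realDiagonal_isSymm L dV hdV) hW
        (isUnit_det_realDiagonal L dV hdV hdV0) hWd (realDiagonal_map L dV hdV).symm hJW
        (isCompatible_chiSplittingLine L e dV hdV hdV0 χ hχu hχs TW hW hWd JW hJW) p
        ((finSBReindex (Fp L) e).symm (piProdSB (Fp L) (Fin n) Φ)) =
      (finSBReindex (Fp L) e).symm (piProdSB (Fp L) (Fin n)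
        (RestrictedFamily.smul
          (congrW L e dV hdV (lineW L TW) (complexConj_lineW L TW) (realDiagonal_lineW L TW) (diagonal_lineW L TW hJW)
            (undoubledSplittings L e dV hdV hdV0 (lineW L TW) (complexConj_lineW L TW) (lineW_ne_zero L TW hWd) χ
              (borelPlaceMeasure L)
              (cmFinLocalFamily L e dV hdV hdV0 (lineW L TW) (complexConj_lineW L TW) (lineW_ne_zero L TW hWd) χ hχs
                (borelPlaceMeasure L)))
            hW hJW).omegaLoc
          (congrW L e dV hdV (lineW L TW) (complexConj_lineW L TW) (realDiagonal_lineW L TW) (diagonal_lineW L TW hJW)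
            (undoubledSplittings L e dV hdV hdV0 (lineW L TW) (complexConj_lineW L TW) (lineW_ne_zero L TW hWd) χ
              (borelPlaceMeasure L)
              (cmFinLocalFamily L e dV hdV hdV0 (lineW L TW) (complexConj_lineW L TW) (lineW_ne_zero L TW hWd) χ hχs
                (borelPlaceMeasure L)))
            hW hJW).unitVec_mem_fixedPoints
          (UnitaryGroup.finAdelicEquiv (Fp L) L (IsCMField.complexConj L) n (Matrix.reindex e e (Matrix.diagonal dV ⊗ₖ JW))
            (finPairEmb (Fp L) L (IsCMField.complexConj L) N 1 e (Matrix.diagonal dV) JW p))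
          Φ)) := by
  rw [finPairRep_chiSplittingLine_apply, LinearEquiv.apply_symm_apply, LocalSplitting.FinLocalSplittings.Omega_piProdSB]

/-! ## §3 The two members -/

/-- the `U(diag dV)`-member: `ω_f^{s_χ}((k, 1)) f = R_e⁻¹ (Ω_χ(reindex (k ⊗ 1)) (R_e f))`.
[cite: GelbartRogawski1991, §3.1 Prop. 3.1.1 p. 455 L1–3] [cite: Liu2021, App. D §D.1 Step 3 (l. 5221)] -/
theorem finPairRepV_chiSplittingLine_apply
    (k : UnitaryGroup.finAdelic (Fp L) L (IsCMField.complexConj L) N (Matrix.diagonal dV))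
    (f : FinSB (Fp L) (Fin N × Fin 1)) :
    finPairRepV (Fp L) L (IsCMField.complexConj L) N 1 e (Matrix.diagonal dV) JW (complexConj_imagUnit L)
        (imagUnit_ne_zero L) (imagUnit_mul_self L) (realDiagonal_isSymm L dV hdV) hW
        (isUnit_det_realDiagonal L dV hdV hdV0) hWd (realDiagonal_map L dV hdV).symm hJW
        (isCompatible_chiSplittingLine L e dV hdV hdV0 χ hχu hχs TW hW hWd JW hJW) k f =
      (finSBReindex (Fp L) e).symm
        ((congrW L e dV hdV (lineW L TW) (complexConj_lineW L TW) (realDiagonal_lineW L TW) (diagonal_lineW L TW hJW)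
            (undoubledSplittings L e dV hdV hdV0 (lineW L TW) (complexConj_lineW L TW) (lineW_ne_zero L TW hWd) χ
              (borelPlaceMeasure L)
              (cmFinLocalFamily L e dV hdV hdV0 (lineW L TW) (complexConj_lineW L TW) (lineW_ne_zero L TW hWd) χ hχs
                (borelPlaceMeasure L)))
            hW hJW).Omega
          (finPairEmb (Fp L) L (IsCMField.complexConj L) N 1 e (Matrix.diagonal dV) JW (k, 1)) (finSBReindex (Fp L) e f)) :=
  finPairRep_chiSplittingLine_apply L e dV hdV hdV0 χ hχu hχs TW hW hWd JW hJW (k, 1) f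

/-- the `U(J_W)`-member (the torus `E¹(𝔸_f)` of the line): `ω_f^{s_χ}((1, u)) f = R_e⁻¹ (Ω_χ(reindex (1 ⊗ u)) (R_e f))`.
[cite: GelbartRogawski1991, §3.1 Prop. 3.1.1 p. 455 L1–3] [cite: Liu2021, App. D §D.1 Step 3 (l. 5221)] -/
theorem finPairRepW_chiSplittingLine_apply
    (u : UnitaryGroup.finAdelic (Fp L) L (IsCMField.complexConj L) 1 JW) (f : FinSB (Fp L) (Fin N × Fin 1)) :
    finPairRepW (Fp L) L (IsCMField.complexConj L) N 1 e (Matrix.diagonal dV) JW (complexConj_imagUnit L)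
        (imagUnit_ne_zero L) (imagUnit_mul_self L) (realDiagonal_isSymm L dV hdV) hW
        (isUnit_det_realDiagonal L dV hdV hdV0) hWd (realDiagonal_map L dV hdV).symm hJW
        (isCompatible_chiSplittingLine L e dV hdV hdV0 χ hχu hχs TW hW hWd JW hJW) u f =
      (finSBReindex (Fp L) e).symm
        ((congrW L e dV hdV (lineW L TW) (complexConj_lineW L TW) (realDiagonal_lineW L TW) (diagonal_lineW L TW hJW)
            (undoubledSplittings L e dV hdV hdV0 (lineW L TW) (complexConj_lineW L TW) (lineW_ne_zero L TW hWd) χ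
              (borelPlaceMeasure L)
              (cmFinLocalFamily L e dV hdV hdV0 (lineW L TW) (complexConj_lineW L TW) (lineW_ne_zero L TW hWd) χ hχs
                (borelPlaceMeasure L)))
            hW hJW).Omega
          (finPairEmb (Fp L) L (IsCMField.complexConj L) N 1 e (Matrix.diagonal dV) JW (1, u)) (finSBReindex (Fp L) e f)) :=
  finPairRep_chiSplittingLine_apply L e dV hdV hdV0 χ hχu hχs TW hW hWd JW hJW (1, u) f

end Literature.NumberTheory.GelbartRogawski1991.UnitaryDualPair.WeilCoinv

end
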